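import Summits.BirchSwinnertonDyer.BirchSwinnertonDyer.Theorems.EisensteinPrimesUnrSelmerQuotientTorsionFiniteChar
import HarnessLib

/-!
# `(H¹_{𝓕_Gr^{S₂}}/H¹_{𝓕_Gr^{S₁}})[p]` is FINITE whenever `(H¹_{𝓕_nr^{S₂}}/H¹_{𝓕_nr^{S₁}})[p]` is — the STRICT
# (`grSelmer`) twin of the "`Q[p]` finite" port, for a GENERIC module

Cell `bsd-eis` (home `run/shared/lean/pub/bsd-eis/`), width seat `bsd-line-x2-p2` g27, crux 4
`BSDpOnCellC` (stmt-BirchSwinnertonDyer-19034), line `telescope` v21 (skeleton of record 9eb63b9f…,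
UNCHANGED; helper `--supports`, no stub closed). Companion of the seat's
`EisensteinPrimesGrSelmerImprimitiveFiniteness` (GV 2000 Cor. (2.3) for the STRICT groups, UP
direction, hypothesis `Finite (Q_Gr[p])`): this file supplies that hypothesis.

* §1 (generic: any number field, any `ℤ_p`-extension `κ`, any module `M`, any place `vbar`, any
  `S₁ ⊆ S₂`): `grSelmer_eq_grSelmer_inf_unrSelmer` — `H¹_{𝓕_Gr^{S₁}} = H¹_{𝓕_Gr^{S₂}} ⊓ H¹_{𝓕_nr^{S₁}}`
  (the strict and the unramified groups share the ramification conditions off `p` and differ only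
  above `vbar`); hence the natural map `Q_Gr = H¹_{𝓕_Gr^{S₂}}/H¹_{𝓕_Gr^{S₁}} → Q_nr =
  H¹_{𝓕_nr^{S₂}}/H¹_{𝓕_nr^{S₁}}` is INJECTIVE (`quotientMap_grSelmer_injective`) and
  **`finite_torsionBy_grSelmer_quotient_of_unrSelmer`**: `Q_nr[p]` finite ⇒ `Q_Gr[p]` finite.
* §2 (generic `p`-divisible module with finite `p`-torsion of `p`-power order and open stabilisers,
  `γ` a topological generator, `S₀` a finset whose members `v ∤ p` are finitely decomposed in `K_∞`):
  **`finite_torsionBy_grSelmer_quotient`** — `(H¹_{𝓕_Gr^{S₀}}/H¹_{𝓕_Gr})[p]` is finite (§1 ∘ seat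
  k5-c2 g11's `DatumSelmerQuotientTorsionFiniteGeneric.finite_torsionBy_quotient`, p-landed).
* The instance at Castella–Grossi–Lee–Skinner's character modules `(F/𝒪)(θ)` with `S` over primes
  SPLIT in `K` (finitely decomposed in the anticyclotomic tower, Brink 2007 Thm. 2) is in the companion
  `EisensteinPrimesGrDualImprimitiveOfPrimitiveChar` (which imports the Brink bookkeeping of
  `CharGrSelmerCorankGeOfFacts.exists_mem_decomp_apply_ne_one_of_ncard_primesOver_under`).

In CGLS Prop. 1.2.5's printed proof this is the local half of (eq:sur2): «`H¹_{F_Gr}^S(K, M_θ)/H¹_{F_Gr}(K, M_θ)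
↪ ∏_{w ∈ S} H¹(K_w, M_θ)` … each `H¹(K_w, M_θ)` is `Λ`-cotorsion» (Greenberg–Vatsal 2000 Prop. 2.4 shape),
in the currency of `p`-torsion. WHY (C2 programme of the seat lineage, evidence #56 on -19034): with the
companion file it turns "the primitive strict dual `𝔛_θ` is f.g. `Λ`-torsion with `μ = 0`" into "every
`S`-imprimitive strict dual `𝔛_θ^S` is f.g. `Λ`-torsion with `μ = 0`" — the (f.g., torsion, `μ = 0`)
triple of CGLS Prop. 1.2.5 as its crux-4 consumers destructure it — IN THE KERNEL; ONE step of several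
(the primitive triple at the two base-change characters comes from the tree's character main-conjecture
engines; Prop. 1.2.5's DIMENSION clause, also consumed in the cone, is a separate road). Nothing is
«redundant» by this file; 27 names by name of record.

HONEST FRAMING: tool theorems only (no definition, no named fact, no `sorry`, no instance), generic
discrete module over any number field and any `ℤ_p`-extension; nothing here closes a stub of telescope
v21 or discharges a Literature fact by itself; BSD is proved for no curve; no label or count moves
(27 names by name of record).

References: Greenberg–Vatsal 2000 §2 pp. 15–17, 20–21 (arXiv:math/9906215); CGLS 2022 §1.2 Prop. 1.2.5 and
proof (arXiv:2008.02571 Prop. 14); Keller–Yin 2024 §1.2 Rem. 1.2.3 (i), Prop. 1.2.5 (arXiv:2402.12781v2);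
Brink 2007 Thm. 2; Greenberg 1989 p. 98 (strict groups).
-/

set_option linter.dupNamespace false
set_option autoImplicit false

noncomputable section

open scoped Classical AddSubgroup

open NumberField IsDedekindDomain Field
open Literature.NumberTheory.EllipticCurves Literature.NumberTheory.EllipticCurves.GreenbergSelmer
  Literature.NumberTheory.EllipticCurves.GreenbergVatsal2000
  Literature.NumberTheory.EllipticCurves.KellerYin2024
  Literature.NumberTheory.GaloisRepresentations
open Summit.BirchSwinnertonDyer.BirchSwinnertonDyer.Theorems

universe u

namespace Summit.BirchSwinnertonDyer.BirchSwinnertonDyer.Theorems.GrSelmerQuotientTorsionFinite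

/-! ## §1 `H¹_{𝓕_Gr^{S₁}} = H¹_{𝓕_Gr^{S₂}} ⊓ H¹_{𝓕_nr^{S₁}}`; `Q_Gr ↪ Q_nr`; `Q_nr[p]` finite ⇒ `Q_Gr[p]` finite -/

section Generic

variable {K : Type u} [Field K] [NumberField K] {p : ℕ} [Fact p.Prime] (κ : ZpExtension K p)
  {M : Type u} [AddCommGroup M] [DistribMulAction (absoluteGaloisGroup K) M] [TopologicalSpace M]
  [DiscreteTopology M] (vbar : HeightOneSpectrum (𝓞 K))

/-- **`H¹_{𝓕_Gr^{S₁}}(K_∞, M) = H¹_{𝓕_Gr^{S₂}}(K_∞, M) ⊓ H¹_{𝓕_nr^{S₁}}(K_∞, M)` for `S₁ ⊆ S₂`**: the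
strict and the unramified datum Selmer groups are `unramifiedOutside Sᵢ ⊓ (condition above p)` with
the SAME first factor and a STRONGER second factor on the strict side (GV p. 20: "`S^{Σ₀}_A(ℚ_∞) =
ker(H¹(ℚ_Σ/ℚ_∞, A) → ∏_{ℓ ∈ Σ−Σ₀} 𝓗_ℓ(ℚ_∞))`", the strict group being "the kernel of `γ'₀`" with the
same `𝓗_ℓ`, `ℓ ≠ p`). [cite: GreenbergVatsal2000, §2 pp. 15–16, 20 (arXiv:math/9906215)]
[cite: KellerYin2024, §1.2 Def. (1)–(4) and Rem. 1.2.3 (i) (arXiv:2402.12781v2)] -/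
theorem grSelmer_eq_grSelmer_inf_unrSelmer {S₁ S₂ : Set (HeightOneSpectrum (𝓞 K))} (h12 : S₁ ⊆ S₂) :
    grSelmer κ M vbar S₁ = grSelmer κ M vbar S₂ ⊓ unrSelmer κ M vbar S₁ := by
  haveI : κ.kerSubgroup.Normal := by rw [ZpExtension.kerSubgroup]; infer_instance
  refine le_antisymm (le_inf (grSelmer_mono κ M vbar h12) (grSelmer_le_unrSelmer κ M vbar S₁)) ?_
  intro c hc
  obtain ⟨h2, h1⟩ := AddSubgroup.mem_inf.mp hc
  change c ∈ datumStrictSelmerInfty κ M _ S₂ at h2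
  change c ∈ datumSelmerInfty κ M _ S₁ at h1
  change c ∈ datumStrictSelmerInfty κ M _ S₁
  rw [datumStrictSelmerInfty_eq, mem_datumStrictSelmer_iff] at h2 ⊢
  rw [datumSelmerInfty_eq, mem_datumSelmer_iff] at h1
  exact ⟨h1.1, h2.2⟩

/-- **The natural map `H¹_{𝓕_Gr^{S₂}}/H¹_{𝓕_Gr^{S₁}} → H¹_{𝓕_nr^{S₂}}/H¹_{𝓕_nr^{S₁}}` (induced by the
inclusion `H¹_{𝓕_Gr^{S₂}} ≤ H¹_{𝓕_nr^{S₂}}`) is INJECTIVE** for `S₁ ⊆ S₂`: a strict class at `S₂` lying in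
`H¹_{𝓕_nr^{S₁}}` lies in `H¹_{𝓕_Gr^{S₁}}` (`grSelmer_eq_grSelmer_inf_unrSelmer`). Existence form (the map
is `QuotientAddGroup.map` of `AddSubgroup.inclusion`). [cite: GreenbergVatsal2000, §2 pp. 15, 20 (arXiv:math/9906215)] -/
theorem exists_quotientMap_grSelmer_injective {S₁ S₂ : Set (HeightOneSpectrum (𝓞 K))} (h12 : S₁ ⊆ S₂) :
    ∃ f : (↥(grSelmer κ M vbar S₂) ⧸ (grSelmer κ M vbar S₁).addSubgroupOf (grSelmer κ M vbar S₂)) →+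
        (↥(unrSelmer κ M vbar S₂) ⧸ (unrSelmer κ M vbar S₁).addSubgroupOf (unrSelmer κ M vbar S₂)),
      Function.Injective f ∧
      ∀ s : grSelmer κ M vbar S₂, f (QuotientAddGroup.mk s) =
        QuotientAddGroup.mk (AddSubgroup.inclusion (grSelmer_le_unrSelmer κ M vbar S₂) s) := by
  let ι : ↥(grSelmer κ M vbar S₂) →+ ↥(unrSelmer κ M vbar S₂) :=
    AddSubgroup.inclusion (grSelmer_le_unrSelmer κ M vbar S₂)
  have hle : (grSelmer κ M vbar S₁).addSubgroupOf (grSelmer κ M vbar S₂) ≤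
      ((unrSelmer κ M vbar S₁).addSubgroupOf (unrSelmer κ M vbar S₂)).comap ι := fun s hs ↦ by
    rw [AddSubgroup.mem_comap, AddSubgroup.mem_addSubgroupOf, AddSubgroup.coe_inclusion]
    exact grSelmer_le_unrSelmer κ M vbar S₁ (AddSubgroup.mem_addSubgroupOf.mp hs)
  refine ⟨QuotientAddGroup.map _ _ ι hle, ?_, fun s ↦ QuotientAddGroup.map_mk _ _ ι hle s⟩
  rw [injective_iff_map_eq_zero]
  intro q hq
  induction q using QuotientAddGroup.induction_on with
  | H s =>
    rw [QuotientAddGroup.map_mk, QuotientAddGroup.eq_zero_iff, AddSubgroup.mem_addSubgroupOf,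
      AddSubgroup.coe_inclusion] at hq
    rw [QuotientAddGroup.eq_zero_iff, AddSubgroup.mem_addSubgroupOf,
      grSelmer_eq_grSelmer_inf_unrSelmer κ vbar h12]
    exact AddSubgroup.mem_inf.mpr ⟨s.2, hq⟩

/-- **`(H¹_{𝓕_nr^{S₂}}/H¹_{𝓕_nr^{S₁}})[p]` finite ⇒ `(H¹_{𝓕_Gr^{S₂}}/H¹_{𝓕_Gr^{S₁}})[p]` finite** (`S₁ ⊆ S₂`;
generic module, any number field, any `ℤ_p`-extension, any `vbar`): the injective quotient map of
`exists_quotientMap_grSelmer_injective` restricts to an injection on `p`-torsion. GV p. 20 ("`𝓗_ℓ(ℚ_∞)`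
is `Λ`-cotorsion", the same local factors for the strict and the non-strict group), in the currency of
`p`-torsion. [cite: GreenbergVatsal2000, §2 pp. 20–21 (arXiv:math/9906215)] -/
theorem finite_torsionBy_grSelmer_quotient_of_unrSelmer {S₁ S₂ : Set (HeightOneSpectrum (𝓞 K))}
    (h12 : S₁ ⊆ S₂)
    (hQ : Finite ((↥(unrSelmer κ M vbar S₂) ⧸
      (unrSelmer κ M vbar S₁).addSubgroupOf (unrSelmer κ M vbar S₂))[(p : ℤ)])) :
    Finite ((↥(grSelmer κ M vbar S₂) ⧸
      (grSelmer κ M vbar S₁).addSubgroupOf (grSelmer κ M vbar S₂))[(p : ℤ)]) := by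
  obtain ⟨f, hf, -⟩ := exists_quotientMap_grSelmer_injective κ (M := M) vbar h12
  haveI := hQ
  have hmem : ∀ q : ((↥(grSelmer κ M vbar S₂) ⧸
      (grSelmer κ M vbar S₁).addSubgroupOf (grSelmer κ M vbar S₂))[(p : ℤ)]),
      f (q : ↥(grSelmer κ M vbar S₂) ⧸ (grSelmer κ M vbar S₁).addSubgroupOf (grSelmer κ M vbar S₂)) ∈
        (↥(unrSelmer κ M vbar S₂) ⧸
          (unrSelmer κ M vbar S₁).addSubgroupOf (unrSelmer κ M vbar S₂))[(p : ℤ)] := fun q ↦ by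
    rw [AddSubgroup.torsionBy.nsmul_iff, ← map_nsmul, AddSubgroup.torsionBy.nsmul_iff.mp q.2, map_zero]
  refine Finite.of_injective (fun q ↦ (⟨f q, hmem q⟩ : (↥(unrSelmer κ M vbar S₂) ⧸
      (unrSelmer κ M vbar S₁).addSubgroupOf (unrSelmer κ M vbar S₂))[(p : ℤ)])) fun q q' h ↦ ?_
  exact Subtype.ext (hf (congrArg Subtype.val h))

/-! ## §2 Generic `p`-divisible module, finitely decomposed `S₀`: `(H¹_{𝓕_Gr^{S₀}}/H¹_{𝓕_Gr})[p]` is finite -/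

/-- **`(H¹_{𝓕_Gr^{S₀}}(K_∞, M)/H¹_{𝓕_Gr}(K_∞, M))[p]` is FINITE** for a generic `p`-divisible discrete
module `M` with open stabilisers and finite `p`-torsion of `p`-power order, `γ` a topological generator
of `κ`, any place `vbar`, and any finset `S₀` whose members `v ∤ p` are finitely decomposed in `K_∞`
(`hD`): §1 on top of the non-strict generic theorem
`DatumSelmerQuotientTorsionFiniteGeneric.finite_torsionBy_quotient` (the finite-coset cover, GV p. 20)
at the Greenberg data `bdpData M p vbar`. [cite: GreenbergVatsal2000, §2 pp. 17, 20–21 (arXiv:math/9906215)] -/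
theorem finite_torsionBy_grSelmer_quotient [Finite ↥(M[(p : ℤ)])]
    (hcard : ∃ k : ℕ, Nat.card ↥(M[(p : ℤ)]) = p ^ k)
    (hdiv : ∀ m : M, ∃ m' : M, p • m' = m)
    (hstab : ∀ m : M,
      IsOpen (MulAction.stabilizer (absoluteGaloisGroup K) m : Set (absoluteGaloisGroup K)))
    {γ : absoluteGaloisGroup K} (hγ : κ.IsTopGenerator γ) (S₀ : Finset (HeightOneSpectrum (𝓞 K)))
    (hD : ∀ v ∈ S₀, ((p : ℕ) : 𝓞 K) ∉ v.asIdeal → ∃ δ ∈ decomp (K := K) v, κ δ ≠ 1) :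
    Finite ((↥(grSelmer κ M vbar (↑S₀ : Set (HeightOneSpectrum (𝓞 K)))) ⧸
      (grSelmer κ M vbar (∅ : Set (HeightOneSpectrum (𝓞 K)))).addSubgroupOf
        (grSelmer κ M vbar (↑S₀ : Set (HeightOneSpectrum (𝓞 K)))))[(p : ℤ)]) :=
  finite_torsionBy_grSelmer_quotient_of_unrSelmer κ vbar (Set.empty_subset _)
    (DatumSelmerQuotientTorsionFiniteGeneric.finite_torsionBy_quotient κ hcard hdiv hstab hγ
      (Castella2018.AcSelmer.bdpData M p vbar) S₀ hD)

end Generic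

end Summit.BirchSwinnertonDyer.BirchSwinnertonDyer.Theorems.GrSelmerQuotientTorsionFinite

end
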